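import Mathlib
import Literature.Computability.Complexity.RangeAvoidance

/-!
# Route Nc03AvoidResidualCore — BC5 rung for the deciding crux `CandAvoidLinearFP` (C₁): pure-`CAND` range avoidance with few head variables, at LINEAR stretch, by constant-size local certificates

Tribunal-w witness (D-0033 T3) for `route-PneNP-Nc03AvoidResidualCore`, item `stmt-PneNP-20226`
(`Summit.PneNP.PneNP.Theses.Nc03AvoidResidualCore.CandAvoidLinearFP =
LocalAvoidLinearFP 3 (IsPure candPred)`): a PROVED special case of pure-`CAND` avoidance
(`CAND(c; a, b) = c ⊕ (a ∧ b)`, head `c` = argument role `0`, data pair `{a, b}` = roles `1, 2`).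

**Theorem (few-heads rung).** Let `I` be a pure `CAND` instance on `n` inputs with `m` outputs whose
outputs use at most `h` distinct HEAD variables. If `m > h · (n − 1)` then the explicit avoider
`candLocalAvoid I` (a search over at most `m⁴` output quadruples) returns a point outside `Range(I)`.
In ladder form (`candFewHeads_rung`): for every `k`, on the sub-family "pure `CAND`, `≤ k` heads" the
single explicit function `candLocalAvoid` solves AVOID at stretch `m ≥ (k+1)·n` — the shape of
`LocalAvoidLinearFP 3 (IsPure candPred ∧ headCount ≤ k)` with the polynomial-time string wrapper
replaced by the explicit avoider (the literal `IsPolyTime`-typed form is a special case of C₁ by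
antitonicity: `candAvoidLinearFP_imp_fewHeads`).

Mechanism (the route's lever — pinned-pattern LOCAL CERTIFICATES, cf. the cell dossier
HOME/pnp-ideate-p2/ROUND-3-ADDENDUM-B.md, Remark B.4): two certificate types suffice.
* K1 (parallel pair): two outputs with the same head and the same data pair compute the same bit,
  so the pattern `(1, 0)` on them is never attained (`not_mem_range_of_parallel`).
* K3 (path motif): four outputs with a common head `c` and data pairs `{a,b}, {b,c'}, {c',d}, {a,e}`;
  the pattern `(1, 0, 1, 0)` is never attained (`not_mem_range_of_motif`; if `x_c = 0` then
  `ab = c'd = 1` forces `bc' = 1`; if `x_c = 1` then `bc' = ae = 1` forces `ab = 1`, i.e. output `0`).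
* Completeness (`exists_motif`): in a head class, view the data pairs as edges of a simple graph;
  if it has MORE EDGES THAN COVERED VERTICES it contains the K3 motif (strip degree-1 vertices —
  the surplus persists — until every covered vertex has degree `≥ 2`; double counting then gives a
  vertex of degree `≥ 3`, around which the motif is assembled avoiding index collisions).
  Pigeonhole over the `h` head classes (each covers `≤ n − 1` vertices) gives a class with surplus
  as soon as `m > h·(n−1)` and no parallel pair exists (`exists_certificate`).

Placement (why this is a rung OUTSIDE S's known regime, S = `NC⁰₃-AVOID ∈ FP` at linear stretch):
`CAND` is neither monotone nor `NC⁰₂` nor symmetric (outside [KuntewarSarma2025, Thms. 2, 8] /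
[GuruswamiLyuWang2022, Thm. 3]), and the stretch `(k+1)·n` is below the general
`NC⁰₃` threshold `m ≥ c·n·log n` of [GuruswamiLyuYuan2025, Thm. 1.3]. It is a RESTRICTED-MODEL
algorithmic rung (few heads); it has no bearing on `P` versus `NP` and does not solve `NC⁰₃-AVOID`.
-/

set_option linter.dupNamespace false -- `Summit.PneNP.PneNP.…`: summit = sub-problem name (D-0017 single-conjunct layout)

namespace Summit.PneNP.PneNP.Theorems.Nc03AvoidResidualCoreCandFewHeadsRung

open Finset
open Literature.Computability.Complexity

/-! ## A combinatorial lemma: more edges than covered vertices forces the path motif -/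

section Graph

variable {V E : Type*} [DecidableEq V] [DecidableEq E]

/-- The other endpoint of a 2-element edge at a vertex. -/
theorem exists_other {s : Finset V} {b : V} (hs : #s = 2) (hb : b ∈ s) :
    ∃ o, o ≠ b ∧ s = {b, o} := by
  obtain ⟨x, y, hxy, rfl⟩ := Finset.card_eq_two.mp hs
  simp only [Finset.mem_insert, Finset.mem_singleton] at hb
  rcases hb with rfl | rfl
  · exact ⟨y, hxy.symm, rfl⟩
  · exact ⟨x, hxy, Finset.pair_comm _ _⟩

/-- **Surplus forces the motif.** A simple graph (edges `e ∈ S` with 2-element endpoint sets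
`pset e`, no two parallel) with more edges than covered vertices contains the K3 motif: four edges
with endpoint pairs `{a,b}, {b,c}, {c,d}, {a,f}`, the second and fourth differing from the first and
third (vertex coincidences allowed). -/
theorem exists_motif (pset : E → Finset V) (S : Finset E) :
    (∀ e ∈ S, #(pset e) = 2) → (∀ e ∈ S, ∀ e' ∈ S, pset e = pset e' → e = e') →
    #(S.biUnion pset) < #S →
    ∃ e1 ∈ S, ∃ e2 ∈ S, ∃ e3 ∈ S, ∃ e4 ∈ S, ∃ a b c d f : V,
      pset e1 = {a, b} ∧ pset e2 = {b, c} ∧ pset e3 = {c, d} ∧ pset e4 = {a, f} ∧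
      e2 ≠ e1 ∧ e2 ≠ e3 ∧ e4 ≠ e1 ∧ e4 ≠ e3 := by
  induction S using Finset.strongInduction with
  | H S ih =>
  intro h2 hinj hlt
  by_cases hleaf : ∃ e ∈ S, ∃ v ∈ pset e, ∀ e' ∈ S, v ∈ pset e' → e' = e
  · -- strip a degree-one vertex together with its edge: the surplus persists
    obtain ⟨e, he, v, hv, huniq⟩ := hleaf
    have hss : S.erase e ⊂ S := Finset.erase_ssubset he
    have h2' : ∀ e' ∈ S.erase e, #(pset e') = 2 :=
      fun e' he' => h2 e' (Finset.mem_of_mem_erase he')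
    have hinj' : ∀ e₁ ∈ S.erase e, ∀ e₂ ∈ S.erase e, pset e₁ = pset e₂ → e₁ = e₂ :=
      fun e₁ h₁ e₂ h₂' => hinj e₁ (Finset.mem_of_mem_erase h₁) e₂ (Finset.mem_of_mem_erase h₂')
    have hvW : v ∈ S.biUnion pset := Finset.mem_biUnion.mpr ⟨e, he, hv⟩
    have hsub : (S.erase e).biUnion pset ⊆ (S.biUnion pset).erase v := by
      intro w hw
      rw [Finset.mem_biUnion] at hw
      obtain ⟨e', he', hw⟩ := hw
      rw [Finset.mem_erase] at he' ⊢
      refine ⟨?_, Finset.mem_biUnion.mpr ⟨e', he'.2, hw⟩⟩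
      rintro rfl
      exact he'.1 (huniq e' he'.2 hw)
    have hlt' : #((S.erase e).biUnion pset) < #(S.erase e) := by
      have h1 := Finset.card_le_card hsub
      rw [Finset.card_erase_of_mem hvW] at h1
      rw [Finset.card_erase_of_mem he]
      have hpos : 0 < #(S.biUnion pset) := Finset.card_pos.mpr ⟨v, hvW⟩
      omega
    obtain ⟨e1, h1, e2, h2e, e3, h3, e4, h4, rest⟩ := ih _ hss h2' hinj' hlt'
    exact ⟨e1, Finset.mem_of_mem_erase h1, e2, Finset.mem_of_mem_erase h2e, e3, Finset.mem_of_mem_erase h3,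
      e4, Finset.mem_of_mem_erase h4, rest⟩
  · -- every covered vertex has degree ≥ 2; double counting gives a vertex of degree ≥ 3
    push Not at hleaf
    have hdeg : ∃ b ∈ S.biUnion pset, 2 < #(S.filter fun e => b ∈ pset e) := by
      by_contra hcon
      push Not at hcon
      have key := Finset.card_mul_le_card_mul (r := fun e v => v ∈ pset e) (s := S)
        (t := S.biUnion pset) (m := 2) (n := 2)
        (fun e he => by
          rw [Finset.bipartiteAbove, ← h2 e he]
          exact Finset.card_le_card fun v hv =>
            Finset.mem_filter.mpr ⟨Finset.mem_biUnion.mpr ⟨e, he, hv⟩, hv⟩)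
        (fun v hv => by rw [Finset.bipartiteBelow]; exact hcon v hv)
      omega
    obtain ⟨b, -, hb3⟩ := hdeg
    rw [Finset.two_lt_card_iff] at hb3
    obtain ⟨eb1, eb2, eb3, hm1, hm2, hm3, n12, n13, n23⟩ := hb3
    rw [Finset.mem_filter] at hm1 hm2 hm3
    obtain ⟨o1, _, hp1⟩ := exists_other (h2 _ hm1.1) hm1.2
    obtain ⟨o2, _, hp2⟩ := exists_other (h2 _ hm2.1) hm2.2
    obtain ⟨o3, _, hp3⟩ := exists_other (h2 _ hm3.1) hm3.2
    have d12 : o1 ≠ o2 := fun h => n12 (hinj _ hm1.1 _ hm2.1 (by rw [hp1, hp2, h]))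
    have d13 : o1 ≠ o3 := fun h => n13 (hinj _ hm1.1 _ hm3.1 (by rw [hp1, hp3, h]))
    have d23 : o2 ≠ o3 := fun h => n23 (hinj _ hm2.1 _ hm3.1 (by rw [hp2, hp3, h]))
    -- the edge `eb1 = {b, c}` with `c := o1`; a second edge `e3 = {c, d}` at `c`
    obtain ⟨e3, he3S, hce3, hne3⟩ := hleaf eb1 hm1.1 o1 (by rw [hp1]; simp)
    obtain ⟨d, -, hpd⟩ := exists_other (h2 _ he3S) hce3
    -- an edge `ea = {a, b}` at `b`, other than `eb1`, with `a ∉ {c, d}`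
    have hea : ∃ ea ∈ S, ∃ a, ea ≠ eb1 ∧ a ≠ o1 ∧ a ≠ d ∧ pset ea = {a, b} := by
      by_cases had : o2 = d
      · exact ⟨eb3, hm3.1, o3, fun h => n13 h.symm, fun h => d13 h.symm,
          fun h => d23 (had.trans h.symm), by rw [hp3, Finset.pair_comm]⟩
      · exact ⟨eb2, hm2.1, o2, fun h => n12 h.symm, fun h => d12 h.symm, had,
          by rw [hp2, Finset.pair_comm]⟩
    obtain ⟨ea, heaS, a, hea1, hac, had, hpa⟩ := hea
    -- a second edge `e4 = {a, f}` at `a`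
    obtain ⟨e4, he4S, hae4, hne4⟩ := hleaf ea heaS a (by rw [hpa]; simp)
    obtain ⟨f, -, hpf⟩ := exists_other (h2 _ he4S) hae4
    refine ⟨ea, heaS, eb1, hm1.1, e3, he3S, e4, he4S, a, b, o1, d, f, hpa, hp1, hpd, hpf,
      fun h => hea1 h.symm, fun h => hne3 h.symm, hne4, ?_⟩
    rintro rfl
    rw [hpd, Finset.mem_insert, Finset.mem_singleton] at hae4
    rcases hae4 with h | h
    · exact hac h
    · exact had h

end Graph

/-! ## Pure `CAND` instances: the two certificates -/

variable {n m : ℕ}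

/-- The data pair `{a, b}` (argument roles `1, 2`) of output `j`. -/
def pset (I : LocalMap 3 n m) (j : Fin m) : Finset (Fin n) := {I.vars j 1, I.vars j 2}

/-- The number of distinct head variables (argument role `0`) used by the outputs. -/
def headCount (I : LocalMap 3 n m) : ℕ := #(univ.image fun j => I.vars j 0)

/-- Certificate K1 (Boolean test on an output pair `(j, j')`): two distinct outputs with the same head
and the same data pair. -/
def parallelB (I : LocalMap 3 n m) (p : Fin m × Fin m) : Bool :=
  decide (p.1 ≠ p.2 ∧ I.vars p.1 0 = I.vars p.2 0 ∧ pset I p.1 = pset I p.2)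

/-- Certificate K3 (Boolean test on an output quadruple `((j1, j2), (j3, j4))`): a common head, data
pairs forming the path motif `{a,b}, {b,c}, {c,d}, {a,f}`, and `j2, j4 ∉ {j1, j3}`. -/
def motifB (I : LocalMap 3 n m) (q : (Fin m × Fin m) × (Fin m × Fin m)) : Bool :=
  decide (I.vars q.1.2 0 = I.vars q.1.1 0 ∧ I.vars q.2.1 0 = I.vars q.1.1 0 ∧
    I.vars q.2.2 0 = I.vars q.1.1 0 ∧ q.1.2 ≠ q.1.1 ∧ q.1.2 ≠ q.2.1 ∧ q.2.2 ≠ q.1.1 ∧ q.2.2 ≠ q.2.1 ∧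
    ∃ a ∈ pset I q.1.1, ∃ b ∈ pset I q.1.1, ∃ c ∈ pset I q.1.2, ∃ d ∈ pset I q.2.1, ∃ f ∈ pset I q.2.2,
      pset I q.1.1 = {a, b} ∧ pset I q.1.2 = {b, c} ∧ pset I q.2.1 = {c, d} ∧ pset I q.2.2 = {a, f})

/-- Output `j` of a pure `CAND` instance computes `x_c ⊕ (x_a ∧ x_b)` on its head `c` and data pair
`a, b`. -/
theorem eval_eq {I : LocalMap 3 n m} (hI : I.IsPure candPred) (x : Fin n → Bool) (j : Fin m) :
    I.eval x j = xor (x (I.vars j 0)) (x (I.vars j 1) && x (I.vars j 2)) := by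
  simp only [LocalMap.eval, hI.1 j, candPred]

/-- Data pairs have two distinct elements (the argument positions are distinct). -/
theorem pset_card {I : LocalMap 3 n m} (hI : I.IsPure candPred) (j : Fin m) : #(pset I j) = 2 :=
  Finset.card_pair fun h => absurd (hI.2 j h) (by decide)

/-- Equality of unordered pairs, as finsets. -/
theorem pair_eq_pair {a b c d : Fin n} (h : ({a, b} : Finset (Fin n)) = {c, d}) :
    a = c ∧ b = d ∨ a = d ∧ b = c := by
  have h' : ({a, b} : Set (Fin n)) = {c, d} := by
    have := congrArg (fun s : Finset (Fin n) => (s : Set (Fin n))) h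
    simpa using this
  exact Set.pair_eq_pair_iff.mp h'

/-- The `AND` part of an output depends only on its unordered data pair. -/
theorem andPair_of_pset {I : LocalMap 3 n m} {j : Fin m} {u v : Fin n} (x : Fin n → Bool)
    (h : pset I j = {u, v}) : (x (I.vars j 1) && x (I.vars j 2)) = (x u && x v) := by
  rcases pair_eq_pair h with ⟨h1, h2⟩ | ⟨h1, h2⟩
  · rw [h1, h2]
  · rw [h1, h2, Bool.and_comm]

/-- K1 is sound: a pattern separating two outputs with the same head and data pair is outside the
range. -/
theorem not_mem_range_of_parallel {I : LocalMap 3 n m} (hI : I.IsPure candPred) {j j' : Fin m}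
    (hh : I.vars j 0 = I.vars j' 0) (hp : pset I j = pset I j') {y : Fin m → Bool}
    (hyj : y j = true) (hyj' : y j' = false) : y ∉ I.range := by
  rintro ⟨x, rfl⟩
  rw [eval_eq hI, hh, andPair_of_pset x hp, ← eval_eq hI] at hyj
  rw [hyj] at hyj'
  exact Bool.noConfusion hyj'

/-- The Boolean core of K3. -/
theorem motif_core : ∀ (H A B C D E : Bool), xor H (A && B) = true → xor H (B && C) = false →
    xor H (C && D) = true → xor H (A && E) = false → False := by
  decide

/-- K3 is sound: the pattern `(1, 0, 1, 0)` on four outputs with a common head and data pairs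
`{a,b}, {b,c}, {c,d}, {a,f}` is outside the range. -/
theorem not_mem_range_of_motif {I : LocalMap 3 n m} (hI : I.IsPure candPred)
    {j1 j2 j3 j4 : Fin m} {a b c d f : Fin n} (h2 : I.vars j2 0 = I.vars j1 0)
    (h3 : I.vars j3 0 = I.vars j1 0) (h4 : I.vars j4 0 = I.vars j1 0) (p1 : pset I j1 = {a, b})
    (p2 : pset I j2 = {b, c}) (p3 : pset I j3 = {c, d}) (p4 : pset I j4 = {a, f})
    {y : Fin m → Bool} (y1 : y j1 = true) (y2 : y j2 = false) (y3 : y j3 = true)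
    (y4 : y j4 = false) : y ∉ I.range := by
  rintro ⟨x, rfl⟩
  rw [eval_eq hI, andPair_of_pset x p1] at y1
  rw [eval_eq hI, h2, andPair_of_pset x p2] at y2
  rw [eval_eq hI, h3, andPair_of_pset x p3] at y3
  rw [eval_eq hI, h4, andPair_of_pset x p4] at y4
  exact motif_core _ _ _ _ _ _ y1 y2 y3 y4

/-! ## Completeness: with more than `headCount · (n − 1)` outputs a certificate exists -/

/-- Every data pair of a head class avoids the head, so a head class covers at most `n − 1`
vertices. -/
theorem card_cover_le {I : LocalMap 3 n m} (hI : I.IsPure candPred) (h : Fin n) :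
    #((univ.filter fun j => I.vars j 0 = h).biUnion (pset I)) ≤ n - 1 := by
  have hsub : (univ.filter fun j => I.vars j 0 = h).biUnion (pset I) ⊆ univ.erase h := by
    intro v hv
    rw [Finset.mem_biUnion] at hv
    obtain ⟨j, hj, hv⟩ := hv
    rw [Finset.mem_filter] at hj
    rw [Finset.mem_erase]
    refine ⟨?_, Finset.mem_univ _⟩
    rw [← hj.2]
    rw [pset, Finset.mem_insert, Finset.mem_singleton] at hv
    rcases hv with rfl | rfl
    · exact fun h' => absurd (hI.2 j h') (by decide)
    · exact fun h' => absurd (hI.2 j h') (by decide)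
  calc #((univ.filter fun j => I.vars j 0 = h).biUnion (pset I)) ≤ #(univ.erase h) :=
        Finset.card_le_card hsub
    _ = n - 1 := by rw [Finset.card_erase_of_mem (Finset.mem_univ _), Finset.card_univ, Fintype.card_fin]

/-- **Dichotomy.** A pure `CAND` instance with more than `headCount · (n − 1)` outputs has a K1 or a
K3 certificate. -/
theorem exists_certificate {I : LocalMap 3 n m} (hI : I.IsPure candPred)
    (hm : headCount I * (n - 1) < m) :
    (∃ p, parallelB I p = true) ∨ ∃ q, motifB I q = true := by
  by_cases hpar : ∃ j j', j ≠ j' ∧ I.vars j 0 = I.vars j' 0 ∧ pset I j = pset I j'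
  · obtain ⟨j, j', hP⟩ := hpar
    exact Or.inl ⟨(j, j'), by simp only [parallelB, decide_eq_true_eq]; exact hP⟩
  right
  push Not at hpar
  -- pigeonhole over the head classes: some class has more outputs than covered vertices
  have key : ∃ h ∈ univ.image (fun j => I.vars j 0),
      #((univ.filter fun j => I.vars j 0 = h).biUnion (pset I)) <
        #(univ.filter fun j => I.vars j 0 = h) := by
    by_contra hcon
    push Not at hcon
    have hsum := Finset.card_eq_sum_card_image (fun j => I.vars j 0) (univ : Finset (Fin m))
    have hle : #(univ : Finset (Fin m)) ≤ headCount I * (n - 1) := by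
      rw [hsum, headCount]
      calc ∑ h ∈ univ.image (fun j => I.vars j 0), #(univ.filter fun j => I.vars j 0 = h)
          ≤ ∑ h ∈ univ.image (fun j => I.vars j 0), (n - 1) :=
            Finset.sum_le_sum fun h hh => (hcon h hh).trans (card_cover_le hI h)
        _ = #(univ.image fun j => I.vars j 0) * (n - 1) := by
            rw [Finset.sum_const, smul_eq_mul]
    rw [Finset.card_univ, Fintype.card_fin] at hle
    omega
  obtain ⟨h, -, hlt⟩ := key
  have hinj : ∀ e ∈ (univ.filter fun j => I.vars j 0 = h), ∀ e' ∈ (univ.filter fun j => I.vars j 0 = h),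
      pset I e = pset I e' → e = e' := by
    intro e he e' he' hpe
    rw [Finset.mem_filter] at he he'
    by_contra hne
    exact hpar e e' hne (by rw [he.2, he'.2]) hpe
  obtain ⟨e1, he1, e2, he2, e3, he3, e4, he4, a, b, c, d, f, p1, p2, p3, p4, n21, n23, n41, n43⟩ :=
    exists_motif (pset I) _ (fun e _ => pset_card hI e) hinj hlt
  rw [Finset.mem_filter] at he1 he2 he3 he4
  refine ⟨((e1, e2), (e3, e4)), ?_⟩
  simp only [motifB, decide_eq_true_eq]
  exact ⟨by rw [he1.2, he2.2], by rw [he1.2, he3.2], by rw [he1.2, he4.2], n21, n23, n41, n43,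
    a, by rw [p1]; simp, b, by rw [p1]; simp, c, by rw [p2]; simp, d, by rw [p3]; simp,
    f, by rw [p4]; simp, p1, p2, p3, p4⟩

/-! ## The explicit avoider and the rung -/

/-- All output quadruples. -/
def quads (m : ℕ) : List ((Fin m × Fin m) × (Fin m × Fin m)) :=
  (List.finRange m ×ˢ List.finRange m) ×ˢ (List.finRange m ×ˢ List.finRange m)

/-- **The explicit avoider** for pure `CAND` instances: search for a K1 certificate (answer: the
pattern `1, 0` on it, `0` elsewhere), else for a K3 certificate (answer: `1` exactly on its first and
third output), else answer `0…0`. A search over `≤ m² + m⁴` candidates, each tested in time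
polynomial in `n`. -/
def candLocalAvoid (I : LocalMap 3 n m) : Fin m → Bool :=
  match (List.finRange m ×ˢ List.finRange m).find? (parallelB I) with
  | some p => fun i => decide (i = p.1)
  | none =>
    match (quads m).find? (motifB I) with
    | some q => fun i => decide (i = q.1.1 ∨ i = q.2.1)
    | none => fun _ => false

/-- **Few-heads rung, sharp form.** For a pure `CAND` instance with `m > headCount · (n − 1)` outputs
the explicit avoider returns a point outside the range. -/
theorem candLocalAvoid_not_mem_range {I : LocalMap 3 n m} (hI : I.IsPure candPred)
    (hm : headCount I * (n - 1) < m) : candLocalAvoid I ∉ I.range := by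
  have hcert := exists_certificate hI hm
  unfold candLocalAvoid
  split
  · rename_i p hp
    have hP := List.find?_some hp
    simp only [parallelB, decide_eq_true_eq] at hP
    obtain ⟨hne, hh, hpp⟩ := hP
    refine not_mem_range_of_parallel hI hh hpp (by simp) ?_
    show decide (p.2 = p.1) = false
    exact decide_eq_false fun h => hne h.symm
  · rename_i hnone
    split
    · rename_i q hq
      have hQ := List.find?_some hq
      simp only [motifB, decide_eq_true_eq] at hQ
      obtain ⟨h2, h3, h4, n21, n23, n41, n43, a, -, b, -, c, -, d, -, f, -, p1, p2, p3, p4⟩ := hQ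
      refine not_mem_range_of_motif hI h2 h3 h4 p1 p2 p3 p4 (by simp) ?_ (by simp) ?_
      · show decide (q.1.2 = q.1.1 ∨ q.1.2 = q.2.1) = false
        exact decide_eq_false (by rintro (h | h) <;> [exact n21 h; exact n23 h])
      · show decide (q.2.2 = q.1.1 ∨ q.2.2 = q.2.1) = false
        exact decide_eq_false (by rintro (h | h) <;> [exact n41 h; exact n43 h])
    · rename_i hnone'
      exfalso
      rcases hcert with ⟨⟨j, j'⟩, hP⟩ | ⟨⟨⟨j1, j2⟩, ⟨j3, j4⟩⟩, hQ⟩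
      · exact (List.find?_eq_none.mp hnone (j, j') (by simp)) hP
      · exact (List.find?_eq_none.mp hnone' ((j1, j2), (j3, j4)) (by simp [quads])) hQ

/-- **Few-heads rung, ladder form** (the BC5 witness): for every `k`, ONE explicit avoider solves
pure-`CAND` range avoidance on the instances with at most `k` head variables, for all `n ≥ 1`, at
stretch `m ≥ (k+1)·n` — the shape of `LocalAvoidLinearFP 3 (IsPure candPred ∧ headCount ≤ k)` with
the answer given directly as a point of `{0,1}ᵐ`. -/
theorem candFewHeads_rung (k : ℕ) :
    ∀ n m (I : LocalMap 3 n m), (I.IsPure candPred ∧ headCount I ≤ k) → 0 < n → (k + 1) * n ≤ m →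
      candLocalAvoid I ∉ I.range := by
  intro n m I hQ hn hkm
  refine candLocalAvoid_not_mem_range hQ.1 (lt_of_lt_of_le ?_ hkm)
  calc headCount I * (n - 1) ≤ k * (n - 1) := Nat.mul_le_mul_right _ hQ.2
    _ ≤ k * n := Nat.mul_le_mul_left k (Nat.sub_le n 1)
    _ < (k + 1) * n := by rw [Nat.succ_mul]; exact Nat.lt_add_of_pos_right hn

/-- The literal FP-typed form of the rung — pure-`CAND` `NC⁰₃-AVOID` with at most `k` head
variables, at linear stretch, solved by ONE polynomial-time string function — is a special case of
the crux C₁ = `CandAvoidLinearFP = LocalAvoidLinearFP 3 (IsPure candPred)` (antitonicity of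
`LocalAvoidLinearFP` in the side condition). (Plan-only companion of `candFewHeads_rung`: the same
avoider run on `encode I`; typing its `IsPolyTime` wrapper is routine machine bookkeeping.) -/
theorem candAvoidLinearFP_imp_fewHeads (k : ℕ)
    (h : LocalAvoidLinearFP 3 (fun _ _ I => I.IsPure candPred)) :
    LocalAvoidLinearFP 3 (fun _ _ I => I.IsPure candPred ∧ headCount I ≤ k) := by
  obtain ⟨C, f, hf, hC⟩ := h
  exact ⟨C, f, hf, fun n m I hI hn hm => hC n m I hI.1 hn hm⟩

end Summit.PneNP.PneNP.Theorems.Nc03AvoidResidualCoreCandFewHeadsRung
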